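import Mathlib
import HarnessLib
import Literature.Analysis.FluidPDE.ClassicalSolution
import Literature.Analysis.FluidPDE.LerayHopf
import Literature.Analysis.FluidPDE.NSCriticalClosureBesovKatoClass
import Summits.NavierStokesRegularity.NavierStokesRegularity.Theses.QuarterJolt
import Summits.NavierStokesRegularity.NavierStokesRegularity.Theorems.QuarterJoltJoltFlatCell
import Summits.NavierStokesRegularity.NavierStokesRegularity.Theorems.QuarterJoltNoFlatCellVertex

/-!
# Route QuarterJolt — the TERMINAL JOLT LAW (by-product of the supports) and the exact position of
# the residue `stub_maximalTime` of crux `NoTerminalJolt` (stmt-NavierStokesRegularity-26463)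

Seat ns-ntj-p1 g0 (LEAD on the crux, line `Cruxes/NoTerminalJolt/Lines/regular_split.lean`); route
header of record (planner ns-idea-9 g2): «files a closer whose by-product is the terminal jolt law: a
quarter-law blow-up has limsup (T−t)^(−1/4)‖u(t)−u(T)‖₂ > 0»; critic idea-crit-8 V25 P1 (verbatim):
«NTJ ⟺_EQL no-blow-up via M-size ε-regularity; deliverable = the Type-I TERMINAL JOLT LAW».

CONTENTS (pure logic over LANDED theorems of the tree — `joltFlatCell_proof` (p615390),
`noFlatCellVertex_proof` (p616987), `exists_singularPoint_of_classical_of_not_hasSmoothExtensionPast`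
(Lemarié-Rieusset 2016 Thm. 15.1 (C), tree theorem)):

* `terminalJoltLaw` — **a quarter-law blow-up jolts**: if `(u, p)` is a MAXIMAL classical solution on
  `[0, T)` (no smooth extension past `T`), Leray–Hopf on `[0, T]` from a rapidly decaying datum, with the
  slice law `∫|curl u(t)|² ≤ K/√(T−t)` on `[0, T)`, then the jolt functional
  `D(t) = (√(T−t))⁻¹ ∫‖u(t) − u(T)‖²` does NOT tend to `0` as `t ↑ T`;
  `exists_frequently_le_joltFunctional` — equivalently `∃ ε > 0` with `D(t) ≥ ε` for `t` arbitrarily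
  close to `T` (`limsup_{t↑T} (T−t)^{−1/2}‖u(t)−u(T)‖₂² > 0`).
* `hasSmoothExtensionPast_of_sliceLaw_of_tendsto_joltFunctional` — the same, read as a continuation
  criterion: slice law + no terminal jolt at `T` ⇒ the solution extends smoothly past `T`.
Consequently (recorded in the line card, not restated here as a theorem): `EnstrophyQuarterLaw`
(stmt-1574) together with the MAXIMAL-TIME half of `NoTerminalJolt` (`stub_maximalTime` of line
`regular_split`) already run the route's assembly `Theses.QuarterJolt.closes`, the regular-time half
being the theorem `NoTerminalJolt.stub_regularTime` (p619494).

HONEST FRAMING: conditional statements about HYPOTHETICAL blow-ups; `EnstrophyQuarterLaw`,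
`NoTerminalJolt` / `stub_maximalTime` and Navier–Stokes regularity are OPEN and nothing here asserts
any of them. No summit statement is proved here. [folklore]
-/

noncomputable section

-- the summit and its single sub-problem share the name (CONVENTIONS §1), as in every Theorems file
set_option linter.dupNamespace false

namespace Summit.NavierStokesRegularity.NavierStokesRegularity.Theorems

open MeasureTheory Set Function Filter Topology
open scoped NNReal ENNReal
open Literature.Analysis.FluidPDE

namespace NoTerminalJolt

/-- **Continuation criterion form.** In the frame of the route (classical on `[0,T)`, Leray–Hopf on
`[0,T]`, rapidly decaying datum), the slice law `∫|curl u(t)|² ≤ K/√(T−t)` on `[0,T)` and NO terminal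
jolt at `T` force a smooth extension past `T`: otherwise
`exists_singularPoint_of_classical_of_not_hasSmoothExtensionPast` gives a singular vertex `(T, x₀)`,
`joltFlatCell_proof` makes its scaled cell energy vanish and `noFlatCellVertex_proof` refutes it. -/
theorem hasSmoothExtensionPast_of_sliceLaw_of_tendsto_joltFunctional {ν T : ℝ} (hν : 0 < ν)
    (hT : 0 < T) {u : ℝ → EuclideanSpace ℝ (Fin 3) → EuclideanSpace ℝ (Fin 3)}
    {p : ℝ → EuclideanSpace ℝ (Fin 3) → ℝ}
    (hcl : IsClassicalNSSolutionOn (Ico 0 T) ν 0 u p) (hLH : IsLerayHopfOn T ν 0 (u 0) u)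
    (hdec : HasRapidSpatialDecay (u 0)) {K : ℝ}
    (hK : ∀ t ∈ Ico 0 T, ∫⁻ x, ‖curl (u t) x‖ₑ ^ 2 ≤ ENNReal.ofReal (K / Real.sqrt (T - t)))
    (hJ : Tendsto (fun t : ℝ => (Real.sqrt (T - t))⁻¹ * ∫ x, ‖u t x - u T x‖ ^ 2)
      (𝓝[<] T) (𝓝 0)) :
    HasSmoothExtensionPast ν 0 u T := by
  by_contra hext
  obtain ⟨x₀, hx₀⟩ :=
    exists_singularPoint_of_classical_of_not_hasSmoothExtensionPast hν hT hcl hLH hdec hext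
  have hflat := joltFlatCell_proof ν T hν hT u p hcl hLH hdec K hK hJ x₀
  exact noFlatCellVertex_proof ν T hν hT u p hcl hLH hdec K hK x₀ hflat hx₀

/-- **The terminal jolt law** (the route's advertised by-product). A MAXIMAL classical solution on
`[0, T)` (first blow-up at `T`), Leray–Hopf on `[0, T]` from a rapidly decaying datum, obeying the slice
quarter law `∫|curl u(t)|² ≤ K/√(T−t)` on `[0, T)`, JOLTS: its jolt functional
`(√(T−t))⁻¹ ∫‖u(t) − u(T)‖²` does not tend to `0` as `t ↑ T` (it approaches the terminal state at the
self-similar `L²` rate along some times). Equivalently: `stub_maximalTime` fails exactly at quarter-law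
blow-ups, so under `EnstrophyQuarterLaw` it is equivalent to their absence. -/
theorem terminalJoltLaw {ν T : ℝ} (hν : 0 < ν) (hT : 0 < T)
    {u : ℝ → EuclideanSpace ℝ (Fin 3) → EuclideanSpace ℝ (Fin 3)}
    {p : ℝ → EuclideanSpace ℝ (Fin 3) → ℝ}
    (hmax : IsMaximalSmoothSolution ν 0 u p T) (hLH : IsLerayHopfOn T ν 0 (u 0) u)
    (hdec : HasRapidSpatialDecay (u 0)) {K : ℝ}
    (hK : ∀ t ∈ Ico 0 T, ∫⁻ x, ‖curl (u t) x‖ₑ ^ 2 ≤ ENNReal.ofReal (K / Real.sqrt (T - t))) :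
    ¬ Tendsto (fun t : ℝ => (Real.sqrt (T - t))⁻¹ * ∫ x, ‖u t x - u T x‖ ^ 2)
      (𝓝[<] T) (𝓝 0) :=
  fun hJ => hmax.2
    (hasSmoothExtensionPast_of_sliceLaw_of_tendsto_joltFunctional hν hT hmax.1 hLH hdec hK hJ)

/-- **The terminal jolt law, `limsup` form**: under the hypotheses of `terminalJoltLaw` there is
`ε > 0` with `(√(T−t))⁻¹ ∫‖u(t) − u(T)‖² ≥ ε` for `t < T` arbitrarily close to `T`, i.e.
`limsup_{t ↑ T} (T−t)^{−1/2} ‖u(t) − u(T)‖₂² > 0` (a nonnegative function that does not tend to `0`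
is frequently bounded below). -/
theorem exists_frequently_le_joltFunctional {ν T : ℝ} (hν : 0 < ν) (hT : 0 < T)
    {u : ℝ → EuclideanSpace ℝ (Fin 3) → EuclideanSpace ℝ (Fin 3)}
    {p : ℝ → EuclideanSpace ℝ (Fin 3) → ℝ}
    (hmax : IsMaximalSmoothSolution ν 0 u p T) (hLH : IsLerayHopfOn T ν 0 (u 0) u)
    (hdec : HasRapidSpatialDecay (u 0)) {K : ℝ}
    (hK : ∀ t ∈ Ico 0 T, ∫⁻ x, ‖curl (u t) x‖ₑ ^ 2 ≤ ENNReal.ofReal (K / Real.sqrt (T - t))) :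
    ∃ ε : ℝ, 0 < ε ∧
      ∃ᶠ t in 𝓝[<] T, ε ≤ (Real.sqrt (T - t))⁻¹ * ∫ x, ‖u t x - u T x‖ ^ 2 := by
  by_contra h
  push Not at h
  refine terminalJoltLaw hν hT hmax hLH hdec hK (tendsto_order.2 ⟨fun a ha => ?_, fun b hb => ?_⟩)
  · exact Eventually.of_forall fun t => ha.trans_le
      (mul_nonneg (inv_nonneg.2 (Real.sqrt_nonneg _)) (integral_nonneg fun _ => sq_nonneg _))
  · exact h b hb

end NoTerminalJolt

end Summit.NavierStokesRegularity.NavierStokesRegularity.Theorems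

end
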